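import Summits.QuantumAdvantage.QuantumAdvantage.Theorems.NearExactIsExact.Negative.QuarterSlicingFourteen

/-!
# A case-A type-O cubic on 14 bits has no rank-4 Dickson block in its digit quadratic
# (THEOREM CA-W, Step 1; NearExactIsExact, disprover gen 23)

Negative/structural lemma for the crux `CubicForrelation.NearExactIsExact` (item r2), finite slice `n = 14`;
ONE-SIDED (no partner `f`).  HONEST FRAMING: a theorem about a single cubic Boolean function on 14 bits — the
"rank ≥ 4" exclusion of Step 1 of THEOREM CA-W (case A ⇒ the digit quadratic `d₁ = [⌊u/2⌋ odd]` has rank exactly `2`;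
rank `0` is `no_caseA_rank_zero`, tree) — NOT summit progress; no violation of `NearExactIsExact`, no per-`n` value.

Statement (`rank_four_caseA_false`, normal form): let `g` be cubic on `14` bits with `W_g = 32u`, every `u(x)` odd
(type O) and CASE A (`[⌊u/2⌋ odd] ≠ [⌊u/4⌋ odd]` everywhere, i.e. `u mod 8 ∈ {3,5}`).  Then the digit quadratic cannot
have the shape `d₁(a₀,a₁,a₂,a₃,a″) = a₀a₁ ⊕ a₂a₃ ⊕ (v·a′) ⊕ λ(a″)` (a Dickson block of rank `4` on the first four dual
coordinates, `λ` arbitrary on the remaining ten) — which is what `rank(d₁) ≥ 4` gives after a `GL(14,2)` change of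
dual coordinates (that normalisation is NOT part of this file).

Proof (4-coordinate slicing at ONE dual point): summing `W_g` over the sixteen dual points `(a′, 0″)` gives
`16 · W_{g(0,0,0,0,·)}(0″)` (`rf_W_pair` four times, from `qs_W_cons`), and `g(0,0,0,0,·)` is a cubic on `10` bits, so
its bias is divisible by `2^{⌈10/3⌉} = 16` (Ax/McEliece, `stub_axParity`); hence `Σ_{a′} u(a′,0″) ∈ 8ℤ`.  But
`u ≡ 5 − 2·d₁ (mod 8)` in case A (`qs_residue`), and `a′ ↦ a₀a₁ ⊕ a₂a₃ ⊕ v·a′ ⊕ λ(0″)` is a bent function on `𝔽₂⁴`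
(weight `6` or `10`), so `Σ_{a′} u(a′,0″) ≡ 80 − 2·wt ≡ 4 (mod 8)`.  Contradiction.

Sources: Ax / McEliece divisibility [cite Carlet2020 §4.1] via the tree lemma `stub_axParity`; bent weights on
`𝔽₂⁴` by exhaustion (`decide`); everything else [this work] / [folklore].  Standard axioms only.
-/

set_option linter.dupNamespace false -- D-0017: single-problem summit ⇒ `QuantumAdvantage.QuantumAdvantage` by design

noncomputable section

namespace Summit.QuantumAdvantage.QuantumAdvantage.Theorems.NearExactIsExact.Negative.RankFourNotCaseAFourteen

open Finset
open Literature.Computability.QuantumComplexity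
open Literature.Computability.QuantumComplexity.DerivativeWalsh (W)
open Summit.QuantumAdvantage.QuantumAdvantage.Theorems.CubicForrelation.NearExactIsExact
open Summit.QuantumAdvantage.QuantumAdvantage.Theorems.NearExactIsExact.Negative.QuarterSlicingFourteen

/-- Pairing the two values of dual coordinate `0`: `W_G(0∷v) + W_G(1∷v) = 2·W_{G(0∷·)}(v)` (Poisson summation
over one coordinate). [folklore] -/
theorem rf_W_pair {k : ℕ} (G : (Fin (k + 1) → Bool) → Bool) (v : Fin k → Bool) :
    W (fun y => signOf (G y)) (Fin.cons false v) + W (fun y => signOf (G y)) (Fin.cons true v) =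
      2 * W (fun y => signOf (G (Fin.cons false y))) v := by
  rw [qs_W_cons G false v, qs_W_cons G true v]
  have s0 : signOf false = 1 := by simp [signOf]
  have s1 : signOf true = -1 := by simp [signOf]
  rw [s0, s1]
  ring

/-- The Walsh transform at the zero dual point is the bias sum. [folklore] -/
theorem rf_W_zero {k : ℕ} (c : (Fin k → Bool) → ℝ) : W c (fun _ => false) = ∑ y, c y := by
  unfold W
  exact sum_congr rfl fun y _ => by rw [show twist y (fun _ => false) = 1 from by simp [twist], mul_one]

/-- A `4`-fold restriction `g(c₀,c₁,c₂,c₃,·)` of a cubic on `14` bits is a cubic on `10` bits. [folklore] -/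
theorem rf_restrict_isDegLeFun (g : (Fin (7 + 7) → Bool) → Bool) (hg : IsDegLeFun 3 g) (c0 c1 c2 c3 : Bool) :
    IsDegLeFun 3 (fun y : Fin 10 → Bool => g (Fin.cons c0 (Fin.cons c1 (Fin.cons c2 (Fin.cons c3 y))))) := by
  refine fc_isDegLeFun_comp (D := 1) hg
    (fun y : Fin 10 → Bool => (Fin.cons c0 (Fin.cons c1 (Fin.cons c2 (Fin.cons c3 y))) : Fin (7 + 7) → Bool))
    (fun v => ?_) (by norm_num)
  refine Fin.cases ?_ (fun v1 => ?_) v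
  · exact isDegLeFun_const 1 c0
  refine Fin.cases ?_ (fun v2 => ?_) v1
  · exact isDegLeFun_const 1 c1
  refine Fin.cases ?_ (fun v3 => ?_) v2
  · exact isDegLeFun_const 1 c2
  refine Fin.cases ?_ (fun j => ?_) v3
  · exact isDegLeFun_const 1 c3
  · exact isDegLeFun_apply j le_rfl

/-- The bent count on `𝔽₂⁴`: `#{a′ : a₀a₁ ⊕ a₂a₃ ⊕ v·a′ ⊕ l = 1} ≡ 2 (mod 4)` (it is `6` or `10`). [folklore] -/
theorem rf_bent_count (v0 v1 v2 v3 l : Bool) :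
    (∑ a0 : Bool, ∑ a1 : Bool, ∑ a2 : Bool, ∑ a3 : Bool,
      (((((a0 && a1) ^^ (a2 && a3)) ^^ ((v0 && a0) ^^ (v1 && a1) ^^ (v2 && a2) ^^ (v3 && a3))) ^^ l).toNat : ℤ)) %
        4 = 2 := by
  simp only [Fintype.sum_bool]
  cases v0 <;> cases v1 <;> cases v2 <;> cases v3 <;> cases l <;> decide

set_option maxHeartbeats 800000 in
/-- **THEOREM CA-W, Step 1 (rank ≥ 4 is not case A; normal form).** For a cubic `g` on `14` bits with `W_g = 32u`,
all `u(x)` odd and `[⌊u/2⌋ odd] ≠ [⌊u/4⌋ odd]` everywhere, the digit `[⌊u/2⌋ odd]` is not of the form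
`a₀a₁ ⊕ a₂a₃ ⊕ v·(a₀,a₁,a₂,a₃) ⊕ λ(a₄,…,a₁₃)`.  ONE-SIDED; NOT summit progress. [this work] -/
theorem rank_four_caseA_false (g : (Fin (7 + 7) → Bool) → Bool) (hg : IsDegLeFun 3 g)
    (u : (Fin (7 + 7) → Bool) → ℤ) (hu : ∀ x, W (fun y => signOf (g y)) x = (2 : ℝ) ^ 5 * (u x : ℝ))
    (hodd : ∀ x, Odd (u x)) (hA : ∀ x, ¬ (Odd (u x / 2) ↔ Odd (u x / 2 / 2)))
    (lam : (Fin 10 → Bool) → Bool) (v0 v1 v2 v3 : Bool)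
    (hd1 : ∀ (a0 a1 a2 a3 : Bool) (a : Fin 10 → Bool),
      Odd (u (Fin.cons a0 (Fin.cons a1 (Fin.cons a2 (Fin.cons a3 a)))) / 2) ↔
        ((((a0 && a1) ^^ (a2 && a3)) ^^ ((v0 && a0) ^^ (v1 && a1) ^^ (v2 && a2) ^^ (v3 && a3))) ^^ lam a) =
          true) :
    False := by
  classical
  -- (1) Ax / McEliece at n = 10: the bias of g(0,0,0,0,·) is divisible by 16
  have hg4 := rf_restrict_isDegLeFun g hg false false false false
  obtain ⟨z', hz'⟩ := stub_axParity 10 3 _ (univ : Finset (Fin 10)) (by norm_num) hg4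
  rw [filter_true_of_mem (fun x _ i _ => mem_univ i), card_univ, Fintype.card_fin,
    show (10 + 3 - 1) / 3 = 4 from by norm_num] at hz'
  have hW4 : W (fun y : Fin 10 → Bool =>
      signOf (g (Fin.cons false (Fin.cons false (Fin.cons false (Fin.cons false y)))))) (fun _ => false) =
        (2 : ℝ) ^ 4 * (z' : ℝ) := by
    rw [rf_W_zero]
    exact hz'
  -- (2) the slicing identity at the dual point (a′, 0″): Σ_{a′} W_g(a′,0″) = 16 · W_{g(0,0,0,0,·)}(0″)
  have h0 : ∀ a1 a2 a3 : Bool,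
      W (fun y => signOf (g y)) (Fin.cons false (Fin.cons a1 (Fin.cons a2 (Fin.cons a3 fun _ => false)))) +
          W (fun y => signOf (g y)) (Fin.cons true (Fin.cons a1 (Fin.cons a2 (Fin.cons a3 fun _ => false)))) =
        2 * W (fun y : Fin 13 → Bool => signOf (g (Fin.cons false y)))
          (Fin.cons a1 (Fin.cons a2 (Fin.cons a3 fun _ => false))) :=
    fun a1 a2 a3 => rf_W_pair (k := 13) g _
  have h1 : ∀ a2 a3 : Bool,
      W (fun y : Fin 13 → Bool => signOf (g (Fin.cons false y)))
            (Fin.cons false (Fin.cons a2 (Fin.cons a3 fun _ => false))) +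
          W (fun y : Fin 13 → Bool => signOf (g (Fin.cons false y)))
            (Fin.cons true (Fin.cons a2 (Fin.cons a3 fun _ => false))) =
        2 * W (fun y : Fin 12 → Bool => signOf (g (Fin.cons false (Fin.cons false y))))
          (Fin.cons a2 (Fin.cons a3 fun _ => false)) :=
    fun a2 a3 => rf_W_pair (k := 12) (fun y : Fin 13 → Bool => g (Fin.cons false y)) _
  have h2 : ∀ a3 : Bool,
      W (fun y : Fin 12 → Bool => signOf (g (Fin.cons false (Fin.cons false y))))
            (Fin.cons false (Fin.cons a3 fun _ => false)) +
          W (fun y : Fin 12 → Bool => signOf (g (Fin.cons false (Fin.cons false y))))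
            (Fin.cons true (Fin.cons a3 fun _ => false)) =
        2 * W (fun y : Fin 11 → Bool => signOf (g (Fin.cons false (Fin.cons false (Fin.cons false y)))))
          (Fin.cons a3 fun _ => false) :=
    fun a3 => rf_W_pair (k := 11) (fun y : Fin 12 → Bool => g (Fin.cons false (Fin.cons false y))) _
  have h3 :
      W (fun y : Fin 11 → Bool => signOf (g (Fin.cons false (Fin.cons false (Fin.cons false y)))))
            (Fin.cons false fun _ => false) +
          W (fun y : Fin 11 → Bool => signOf (g (Fin.cons false (Fin.cons false (Fin.cons false y)))))
            (Fin.cons true fun _ => false) =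
        2 * W (fun y : Fin 10 → Bool =>
            signOf (g (Fin.cons false (Fin.cons false (Fin.cons false (Fin.cons false y)))))) (fun _ => false) :=
    rf_W_pair (k := 10) (fun y : Fin 11 → Bool => g (Fin.cons false (Fin.cons false (Fin.cons false y)))) _
  -- (3) hence Σ_{a′} u(a′,0″) = 8 z′
  have hint : (∑ a0 : Bool, ∑ a1 : Bool, ∑ a2 : Bool, ∑ a3 : Bool,
      u (Fin.cons a0 (Fin.cons a1 (Fin.cons a2 (Fin.cons a3 fun _ => false))))) = 8 * z' := by
    have e := fun a0 a1 a2 a3 : Bool =>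
      hu (Fin.cons a0 (Fin.cons a1 (Fin.cons a2 (Fin.cons a3 fun _ => false))))
    have h' : ((∑ a0 : Bool, ∑ a1 : Bool, ∑ a2 : Bool, ∑ a3 : Bool,
        u (Fin.cons a0 (Fin.cons a1 (Fin.cons a2 (Fin.cons a3 fun _ => false)))) : ℤ) : ℝ) = 8 * (z' : ℝ) := by
      push_cast
      simp only [Fintype.sum_bool]
      linarith [e false false false false, e false false false true, e false false true false,
        e false false true true, e false true false false, e false true false true, e false true true false,
        e false true true true, e true false false false, e true false false true, e true false true false,
        e true false true true, e true true false false, e true true false true, e true true true false,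
        e true true true true, h0 false false false, h0 false false true, h0 false true false, h0 false true true,
        h0 true false false, h0 true false true, h0 true true false, h0 true true true, h1 false false,
        h1 false true, h1 true false, h1 true true, h2 false, h2 true, h3, hW4]
    exact_mod_cast h'
  -- (4) case-A residues on the sixteen points: u ≡ 5 − 2·d₁ (mod 8)
  have hval : ∀ a0 a1 a2 a3 : Bool,
      u (Fin.cons a0 (Fin.cons a1 (Fin.cons a2 (Fin.cons a3 fun _ => false)))) % 8 =
        5 - 2 * (((((a0 && a1) ^^ (a2 && a3)) ^^ ((v0 && a0) ^^ (v1 && a1) ^^ (v2 && a2) ^^ (v3 && a3))) ^^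
          lam fun _ => false).toNat : ℤ) := by
    intro a0 a1 a2 a3
    have hr := qs_residue (u (Fin.cons a0 (Fin.cons a1 (Fin.cons a2 (Fin.cons a3 fun _ => false)))))
      (hodd _) (hA _)
    have hd := hd1 a0 a1 a2 a3 fun _ => false
    cases hb : ((((a0 && a1) ^^ (a2 && a3)) ^^ ((v0 && a0) ^^ (v1 && a1) ^^ (v2 && a2) ^^ (v3 && a3))) ^^
        lam fun _ => false)
    · rw [hb] at hd
      have hno : ¬ Odd (u (Fin.cons a0 (Fin.cons a1 (Fin.cons a2 (Fin.cons a3 fun _ => false)))) / 2) :=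
        fun ho => Bool.noConfusion (hd.1 ho)
      have h5 := hr.2 hno
      simp only [Bool.toNat_false, Nat.cast_zero, mul_zero, sub_zero]
      exact h5
    · rw [hb] at hd
      have h3' := hr.1 (hd.2 rfl)
      simp only [Bool.toNat_true, Nat.cast_one, mul_one]
      omega
  -- (5) the bent count and the final contradiction mod 8
  have hN := rf_bent_count v0 v1 v2 v3 (lam fun _ => false)
  have hint' := hint
  simp only [Fintype.sum_bool] at hint' hN
  have r1 := hval false false false false
  have r2 := hval false false false true
  have r3 := hval false false true false
  have r4 := hval false false true true
  have r5 := hval false true false false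
  have r6 := hval false true false true
  have r7 := hval false true true false
  have r8 := hval false true true true
  have r9 := hval true false false false
  have r10 := hval true false false true
  have r11 := hval true false true false
  have r12 := hval true false true true
  have r13 := hval true true false false
  have r14 := hval true true false true
  have r15 := hval true true true false
  have r16 := hval true true true true
  omega

end Summit.QuantumAdvantage.QuantumAdvantage.Theorems.NearExactIsExact.Negative.RankFourNotCaseAFourteen

end
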